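import Summits.QuantumFields.GaugeBoot.ZdCentralTwistWalks
import Summits.QuantumFields.GaugeBoot.ZdCentralTwistWilsonLoops
import HarnessLib

/-!
# The `ℤ^d` staggered central twist on ARBITRARY Wilson loops: `W_C ↦ (-1)^{a(C)} W_C`, states and
# even-side limit points (gauge-boot, L3 structural supplement; `ℤ^d` twist 9)

HONEST FRAMING (cell `pub-gaugeboot`, page 1 of every file): the venture produces certified bounds
on lattice expectations at stated coupling, gauge group, dimension and torus size; NOT a mass gap,
NOT a continuum limit, NOT a string tension; NOT Yang–Mills-summit-bearing (barriers
`FixedCouplingUltralocality`, `PerturbativeInvisibility`). This module bounds no expectation; no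
certificate of the cell sits at `β < 0` (a mirror value at `-β` obtained from a row at `β` by the
sign rule below is a COROLLARY of that row, not a new certificate, and only for `SU(2n)` / `U(N)`).

Part 7 (`ZdCentralTwistWilsonLoops.lean`) proved `W_{R×T} ↦ (-1)^{RT} W_{R×T}` for rectangles; part 8
(`ZdCentralTwistWalks.lean`) proved that under the parity staggering `T = centralTwist (stagTwist π r z)`
every walk `w` collects `z^{twistParity π r w}` and that on a CLOSED walk this exponent is the lattice
area parity `a(C) = areaParity π C = ∑_{i<k} S_{ik}(C)` (mod-2 shoelace areas of the coordinate-plane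
projections; the parity of the winding-number weighted number of unit squares of any lattice surface
bounded by `C`). This file draws the consequences for EVERY closed walk `C` of `ℤ^d`, every `d`:

* `shoelaceParity_eq_coord`, `areaParity_eq_coord` — on `ℤ^d` the parities are the coordinate
  shoelace sums `∑_{e ∈ C, dir e = k} (start e)_i (mod 2)` (no choice involved);
* ★★ `walkHolonomy_centralTwist_stagTwist_closed` — **`hol_C(T U) = z^{a(C)} · hol_C(U)`**, and
  ★★ `wilsonLoopObs_centralTwist` — **`W_C(T U) = (-1)^{a(C)} W_C(U)`** (`ρ z = -1`);
* ★★ `integral_wilsonLoopObs_map_centralTwist` / `loopExpectation_map_centralTwist` —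
  `⟨W_C⟩_{μ ∘ T⁻¹} = (-1)^{a(C)} ⟨W_C⟩_μ` for every measure `μ`;
* ★★★ `exists_limit_integral_wilsonLoopObs_neg`, `limitValues_wilsonLoop_neg_closed` (+ `_suEven`,
  `_uN`) — **the even-side infinite-volume limit-point values of EVERY Wilson loop at `-β` are exactly
  `(-1)^{a(C)}` times those at `β`** (along the same sequence of even sides; the twist is a bijection of
  limit points, part 4) — the loop-general form of part 7's `limitValues_wilsonLoop_neg`.

`areaParity π (rectWalk x i j R T) = RT` is `ZdCentralTwistRectangleArea.lean`. What is NOT claimed: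
nothing for odd sides or `SU(2n+1)`; no bound. [folklore] bookkeeping (Kogut–Susskind 1975;
Li–Meurice 2005 §II; Wilson 1974).
-/

noncomputable section

open MeasureTheory Filter Topology SimpleGraph
open Literature.Probability.LatticeModels (Site zdGraph)
open Literature.MathematicalPhysics.QuantumLattice

namespace Summit.QuantumFields.GaugeBoot

namespace TiltedRP

variable {d N : ℕ} {G : Type*} [Group G]

/-! ## Closed walks: `hol_C(T U) = z^{a(C)} hol_C(U)` and `W_C(T U) = (-1)^{a(C)} W_C(U)` -/

section Closed

variable {z : G} {π : Fin d → Site d →+ ZMod 2}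

/-- **On `ℤ^d` the shoelace parities are the coordinate shoelace sums**:
`S_{ik}(w) = ∑_{e ∈ w, dir e = k} (start e)_i (mod 2)` (the dual parities of `(ℤ^d, zdUnit)` are the
coordinate parities, `IsDualParity.apply_zd`). -/
theorem shoelaceParity_eq_coord (hπ : IsDualParity (zdUnit d) π) (i k : Fin d) {x y : Site d}
    (w : (zdGraph d).Walk x y) :
    shoelaceParity π i k w =
      (w.darts.map fun e => if k = dartDir e then ((e.fst i : ℤ) : ZMod 2) else 0).sum := by
  unfold shoelaceParity
  simp only [hπ.apply_zd]

/-- Hence the area parity does not depend on the choice of dual parities `π` (there is none on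
`ℤ^d`): `a(w) = ∑_{i<k} ∑_{e ∈ w, dir e = k} (start e)_i (mod 2)`. -/
theorem areaParity_eq_coord (hπ : IsDualParity (zdUnit d) π) {x y : Site d}
    (w : (zdGraph d).Walk x y) :
    areaParity π w = ∑ i, ∑ k, if i < k then
      (w.darts.map fun e => if k = dartDir e then ((e.fst i : ℤ) : ZMod 2) else 0).sum else 0 := by
  unfold areaParity
  simp only [shoelaceParity_eq_coord hπ]

/-- ★★ **The twist on the holonomy of a CLOSED walk: `hol_C(T U) = z^{a(C)} · hol_C(U)`** with `a(C)`
the lattice area parity — every closed walk of `ℤ^d`, every `d`, every axis `r` last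
(`z` central, `z² = 1`). -/
theorem walkHolonomy_centralTwist_stagTwist_closed (hπ : IsDualParity (zdUnit d) π)
    (hzc : ∀ g : G, z * g = g * z) (hz2 : z * z = 1) (r : Fin d) (U : LGConfig d G) {x : Site d}
    (w : (zdGraph d).Walk x x) :
    walkHolonomy (centralTwist (stagTwist π r z) U) w =
      zpow₂ z (areaParity π w) * walkHolonomy U w := by
  rw [walkHolonomy_centralTwist_stagTwist hπ hzc hz2 r U w, twistParity_eq_areaParity hπ r w]

variable (ρ : G →* Matrix (Fin N) (Fin N) ℂ)

/-- `ρ(z^a) = (-1)^{a.val} · 1` for `a ∈ ℤ/2` when `ρ z = -1`. -/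
theorem rep_zpow₂ (hρz : ρ z = -1) (a : ZMod 2) :
    ρ (zpow₂ z a) = ((-1 : ℝ) ^ a.val : ℝ) • (1 : Matrix (Fin N) (Fin N) ℂ) := by
  have h := rep_zpow₂_natCast ρ hρz a.val
  rwa [ZMod.natCast_zmod_val] at h

/-- ★★ **`W_C(T U) = (-1)^{a(C)} W_C(U)` for EVERY closed walk `C` of `ℤ^d`** and the
normalised-character Wilson loop observable (`ρ z = -1`). -/
theorem wilsonLoopObs_centralTwist (hπ : IsDualParity (zdUnit d) π)
    (hzc : ∀ g : G, z * g = g * z) (hz2 : z * z = 1) (hρz : ρ z = -1) (r : Fin d) {x : Site d}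
    (w : (zdGraph d).Walk x x) (U : LGConfig d G) :
    wilsonLoopObs (normalisedCharacter N ∘ ρ) w (centralTwist (stagTwist π r z) U) =
      (-1 : ℝ) ^ (areaParity π w).val * wilsonLoopObs (normalisedCharacter N ∘ ρ) w U := by
  simp only [wilsonLoopObs, Function.comp_apply, normalisedCharacter]
  rw [walkHolonomy_centralTwist_stagTwist_closed hπ hzc hz2 r U w, map_mul, rep_zpow₂ ρ hρz,
    smul_mul_assoc, one_mul, Matrix.trace_smul, Complex.smul_re, smul_eq_mul]
  ring

end Closed

/-! ## Measures and even-side limit points: every Wilson loop -/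

section Limits

variable [TopologicalSpace G] [IsTopologicalGroup G] [CompactSpace G] [MeasurableSpace G]
  [BorelSpace G] [SecondCountableTopology G]
variable (ρ : G →* Matrix (Fin N) (Fin N) ℂ) {z : G} {π : Fin d → Site d →+ ZMod 2}

omit [CompactSpace G] in
/-- ★★ **`∫ W_C d(μ ∘ T⁻¹) = (-1)^{a(C)} ∫ W_C dμ`** for every measure `μ` on `ℤ^d` configurations
and every closed walk `C` (`ρ` continuous with `ρ z = -1`). -/
theorem integral_wilsonLoopObs_map_centralTwist (hπ : IsDualParity (zdUnit d) π)
    (hzc : ∀ g : G, z * g = g * z) (hz2 : z * z = 1) (hρ : Continuous ρ) (hρz : ρ z = -1)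
    (r : Fin d) (μ : Measure (LGConfig d G)) {x : Site d} (w : (zdGraph d).Walk x x) :
    ∫ U, wilsonLoopObs (normalisedCharacter N ∘ ρ) w U ∂(μ.map (centralTwist (stagTwist π r z))) =
      (-1 : ℝ) ^ (areaParity π w).val * ∫ U, wilsonLoopObs (normalisedCharacter N ∘ ρ) w U ∂μ := by
  rw [integral_map_centralTwist _ μ (F := wilsonLoopObs (normalisedCharacter N ∘ ρ) w)
    (continuous_wilsonLoopObs (continuous_normalisedCharacter_comp hρ) _), ← integral_const_mul]
  exact integral_congr_ae (ae_of_all _ fun U => wilsonLoopObs_centralTwist ρ hπ hzc hz2 hρz r w U)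

omit [CompactSpace G] in
/-- **The loop expectation of the twisted state**: `⟨W_C⟩_{μ ∘ T⁻¹} = (-1)^{a(C)} ⟨W_C⟩_μ`
(the tree's `loopExpectation`). -/
theorem loopExpectation_map_centralTwist (hπ : IsDualParity (zdUnit d) π)
    (hzc : ∀ g : G, z * g = g * z) (hz2 : z * z = 1) (hρ : Continuous ρ) (hρz : ρ z = -1)
    (r : Fin d) (μ : Measure (LGConfig d G)) {x : Site d} (w : (zdGraph d).Walk x x) :
    loopExpectation (μ.map (centralTwist (stagTwist π r z))) (normalisedCharacter N ∘ ρ) w =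
      (-1 : ℝ) ^ (areaParity π w).val * loopExpectation μ (normalisedCharacter N ∘ ρ) w :=
  integral_wilsonLoopObs_map_centralTwist ρ hπ hzc hz2 hρ hρz r μ w

end Limits

section LimitsTorus

open Literature.MathematicalPhysics.QuantumLattice (fundamentalRep unitaryFundamentalRep
  continuous_fundamentalRep continuous_unitaryFundamentalRep)

variable {G : Type} [Group G] [TopologicalSpace G] [IsTopologicalGroup G] [CompactSpace G]
  [MeasurableSpace G] [BorelSpace G] [SecondCountableTopology G]
variable (ρ : G →* Matrix (Fin N) (Fin N) ℂ) {z : G} {π : Fin d → Site d →+ ZMod 2}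

/-- ★★★ **Even-side limit-point Wilson loops at `-β`, every loop.** If `μ` is an infinite-volume
limit of the torus Wilson states at `β` along a sequence of even sides, then `ν = μ ∘ T⁻¹` is one at
`-β` along the same sequence and `∫ W_C dν = (-1)^{a(C)} ∫ W_C dμ` for EVERY closed walk `C` of `ℤ^d`
(`ρ` continuous with `ρ z = -1`). -/
theorem exists_limit_integral_wilsonLoopObs_neg (hπ : IsDualParity (zdUnit d) π)
    (hzc : ∀ g : G, z * g = g * z) (hz2 : z * z = 1) (hρ : Continuous ρ) (hρz : ρ z = -1)
    (r : Fin d) {β : ℝ} {Lk : ℕ → ℕ} (heven : ∀ k, 2 ∣ Lk k + 1) {μ : Measure (LGConfig d G)}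
    (hμ : IsInfiniteVolumeLimitAlong ρ β Lk μ) :
    ∃ ν : Measure (LGConfig d G), IsInfiniteVolumeLimitAlong ρ (-β) Lk ν ∧
      ∀ (x : Site d) (w : (zdGraph d).Walk x x),
        ∫ U, wilsonLoopObs (normalisedCharacter N ∘ ρ) w U ∂ν =
          (-1 : ℝ) ^ (areaParity π w).val * ∫ U, wilsonLoopObs (normalisedCharacter N ∘ ρ) w U ∂μ :=
  ⟨_, hμ.map_centralTwist ρ hπ r hρ hzc hz2 hρz heven, fun _ w =>
    integral_wilsonLoopObs_map_centralTwist ρ hπ hzc hz2 hρ hρz r μ w⟩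

/-- ★★★ **The sets of even-side limit-point values of `W_C` at `β` and at `-β` determine each other,
for every closed walk `C`**: `v` is the value `∫ W_C dν` at some even-side limit `ν` at `-β` (along
`Lk`) iff `(-1)^{a(C)} v` is the value at some even-side limit at `β`. -/
theorem limitValues_wilsonLoop_neg_closed (hπ : IsDualParity (zdUnit d) π)
    (hzc : ∀ g : G, z * g = g * z) (hz2 : z * z = 1) (hρ : Continuous ρ) (hρz : ρ z = -1)
    (r : Fin d) (β : ℝ) {Lk : ℕ → ℕ} (heven : ∀ k, 2 ∣ Lk k + 1) {x : Site d}
    (w : (zdGraph d).Walk x x) (v : ℝ) :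
    (∃ ν : Measure (LGConfig d G), IsInfiniteVolumeLimitAlong ρ (-β) Lk ν ∧
        ∫ U, wilsonLoopObs (normalisedCharacter N ∘ ρ) w U ∂ν = v) ↔
      ∃ μ : Measure (LGConfig d G), IsInfiniteVolumeLimitAlong ρ β Lk μ ∧
        ∫ U, wilsonLoopObs (normalisedCharacter N ∘ ρ) w U ∂μ = (-1 : ℝ) ^ (areaParity π w).val * v := by
  have hsq : ((-1 : ℝ) ^ (areaParity π w).val) * (-1 : ℝ) ^ (areaParity π w).val = 1 := by
    rw [← mul_pow, neg_one_mul, neg_neg, one_pow]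
  constructor
  · rintro ⟨ν, hν, hv⟩
    refine ⟨ν.map (centralTwist (stagTwist π r z)), ?_, ?_⟩
    · have h := hν.map_centralTwist ρ hπ r hρ hzc hz2 hρz heven
      rwa [neg_neg] at h
    · rw [integral_wilsonLoopObs_map_centralTwist ρ hπ hzc hz2 hρ hρz r ν w, hv]
  · rintro ⟨μ, hμ, hv⟩
    refine ⟨μ.map (centralTwist (stagTwist π r z)), hμ.map_centralTwist ρ hπ r hρ hzc hz2 hρz heven, ?_⟩
    rw [integral_wilsonLoopObs_map_centralTwist ρ hπ hzc hz2 hρ hρz r μ w, hv, ← mul_assoc, hsq,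
      one_mul]

/-- ★★★ **`SU(M)`, `M` even (so `SU(2)`)**: the even-side limit-point values of `W̄_C` at `-β_tree`
are exactly `(-1)^{a(C)}` times those at `β_tree`, every `d`, every closed walk `C`. -/
theorem limitValues_wilsonLoop_neg_closed_suEven {M : ℕ} (hM : Even M) {d : ℕ}
    {π : Fin d → Site d →+ ZMod 2} (hπ : IsDualParity (zdUnit d) π) (r : Fin d) (β : ℝ)
    {Lk : ℕ → ℕ} (heven : ∀ k, 2 ∣ Lk k + 1) {x : Site d} (w : (zdGraph d).Walk x x) (v : ℝ) :
    (∃ ν : Measure (LGConfig d (Matrix.specialUnitaryGroup (Fin M) ℂ)),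
        IsInfiniteVolumeLimitAlong (fundamentalRep (Fin M)) (-β) Lk ν ∧
        ∫ U, wilsonLoopObs (normalisedCharacter M ∘ fundamentalRep (Fin M)) w U ∂ν = v) ↔
      ∃ μ : Measure (LGConfig d (Matrix.specialUnitaryGroup (Fin M) ℂ)),
        IsInfiniteVolumeLimitAlong (fundamentalRep (Fin M)) β Lk μ ∧
        ∫ U, wilsonLoopObs (normalisedCharacter M ∘ fundamentalRep (Fin M)) w U ∂μ =
          (-1 : ℝ) ^ (areaParity π w).val * v :=
  limitValues_wilsonLoop_neg_closed (fundamentalRep (Fin M))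
    (z := ⟨-1, neg_one_mem_specialUnitaryGroup_of_even hM⟩) hπ (fun g => Subtype.ext (by simp))
    (Subtype.ext (by simp)) (continuous_fundamentalRep (Fin M)) (by rw [fundamentalRep_apply]) r β
    heven w v

/-- ★★★ **`U(N)`**: the same for the unitary group in the defining representation. -/
theorem limitValues_wilsonLoop_neg_closed_uN {N d : ℕ} {π : Fin d → Site d →+ ZMod 2}
    (hπ : IsDualParity (zdUnit d) π) (r : Fin d) (β : ℝ) {Lk : ℕ → ℕ} (heven : ∀ k, 2 ∣ Lk k + 1)
    {x : Site d} (w : (zdGraph d).Walk x x) (v : ℝ) :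
    (∃ ν : Measure (LGConfig d (Matrix.unitaryGroup (Fin N) ℂ)),
        IsInfiniteVolumeLimitAlong (unitaryFundamentalRep (Fin N) ℂ) (-β) Lk ν ∧
        ∫ U, wilsonLoopObs (normalisedCharacter N ∘ unitaryFundamentalRep (Fin N) ℂ) w U ∂ν = v) ↔
      ∃ μ : Measure (LGConfig d (Matrix.unitaryGroup (Fin N) ℂ)),
        IsInfiniteVolumeLimitAlong (unitaryFundamentalRep (Fin N) ℂ) β Lk μ ∧
        ∫ U, wilsonLoopObs (normalisedCharacter N ∘ unitaryFundamentalRep (Fin N) ℂ) w U ∂μ =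
          (-1 : ℝ) ^ (areaParity π w).val * v :=
  limitValues_wilsonLoop_neg_closed (unitaryFundamentalRep (Fin N) ℂ)
    (z := ⟨-1, by simp [Matrix.mem_unitaryGroup_iff]⟩) hπ (fun g => Subtype.ext (by simp))
    (Subtype.ext (by simp)) (continuous_unitaryFundamentalRep (Fin N) ℂ) rfl r β heven w v

end LimitsTorus

end TiltedRP

end Summit.QuantumFields.GaugeBoot
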